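import Mathlib
import Literature.NumberTheory.LFunctions.Zhang2022.Section4PerronIntegrability
import Literature.NumberTheory.LFunctions.Zhang2022.Section4TildeZ
import Literature.NumberTheory.LFunctions.RamanujanDivisorSquare
import Literature.NumberTheory.Sieve.DivisorBound
import HarnessLib

/-!
# Zhang (2022) §4, proof of Lemma 4.4: generic estimates for the shifted Perron contours of
# (4.7)–(4.9) — Gaussian tails of `ω₁`, the tail series `Σ_{n>P²}ν(n)ψ̄(n)n^{−z}`, and the
# Stirling size of `Z̃(s+w,ψ)` at all heights

Topic `Literature/NumberTheory/LFunctions/Zhang2022` (Landau–Siegel audit tree; verdict-neutral;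
D-0069 campaign nodes **Z22:§4.u030–u037** / **Z22:(4.7)–(4.9)**, locator [Z22 pp.19–21, proof of
Lemma 4.4, tex L1086–L1125]). Y. Zhang, *Discrete mean estimates and the Landau–Siegel zero*,
arXiv:2211.02515v1 (2022) [Zhang2022LandauSiegel] — **an unrefereed manuscript under adjudication**:

> To prove (4.7) [(4.8), (4.9)] we move the contour of integration to the vertical segments
> `w = 10 + iv` [`−α + iv`, `−σ−10 + iv`] with `|v| < 𝓛²⁰`, `w = −σ−1/2 + iv` with `|v| ≥ 𝓛²⁰`, and to
> the two connecting horizontal segments `w = u ± i𝓛²⁰` […]. By a trivial bound for `ω₁(w)`, (4.5)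
> [and trivial bounds for the involved sum] …

This file supplies the "trivial bounds" as theorems (no definition, no named fact), for the
dischargers of `Section4.Contour47Bound` / `Line48Bound` / `Contour49Bound`:

* `integral_Ioi_sq_mul_gauss_le` — the Gaussian tail with a quadratic weight:
  `∫_{v>V} (A + v²)e^{−v²/(4Λ)} dv ≤ e^{−V²/(8Λ)}(A + 16Λ)√(16πΛ)` (`A ≥ 0`, `Λ > 0`, `V ≥ 0`), and
  the mirror `integral_Iic_sq_mul_gauss_le`;
* `norm_tailSum_le_uniform` / `norm_tailSum_le_mul_rpow` — the tail `Σ_{n>P²}ν(n)ψ̄(n)n^{−z}` of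
  `L(z,ψ̄)L(z,χψ̄)` (`Section4.tailSum`): for `Re z ≥ 3/2`, `|tailSum z| ≤ T` with the absolute
  `T = C_τ Σ n^{−5/4}` (`|ν(n)| ≤ τ(n) ≤ C_τ n^{1/4}`, tree `norm_divisorSumChar_le`,
  `Sieve.exists_card_divisors_le_mul_rpow`), and for `Re z ≥ 3/2 + b`, `b ≥ 0`,
  `|tailSum z| ≤ (P²)^{−b}·T` (termwise `n^{−b} ≤ (P²)^{−b}` for `n > P²`);
* `norm_tildeZ_le_two_mul` — **(4.5) as an upper bound at every height** (tree Stirling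
  `GammaFactor.abs_norm_tildeZ_sub_le` with `A = 11`): for primitive `ψ (mod k₁)`, `θ₂ (mod k₂)`,
  `|σ′| ≤ 11`, `t′ ≥ 82080`: `|Z̃(σ′+it′)| ≤ 2(k₁k₂(t′/2π)²)^{1/2−σ′}`.

WHAT THIS IS NOT: any statement about Theorems 1–2 of the manuscript or about Landau–Siegel zeros.

## References

* Y. Zhang, arXiv:2211.02515v1 (2022), §4 pp.19–21 (proof of Lemma 4.4), (4.5).
  [cite: Zhang2022LandauSiegel, §4 Lemma 4.4 (proof)]
* G. H. Hardy, E. M. Wright, *An Introduction to the Theory of Numbers*, Thm 315 (through the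
  tree's `Sieve.DivisorBound`). [cite: HardyWright2008, Theorem 315]
-/

noncomputable section

open Complex Real Set MeasureTheory

namespace Literature.NumberTheory.LFunctions.Zhang2022.Section4

open Skeleton

/-! ### Gaussian tails with a quadratic weight -/

/-- `y·e^{−y} ≤ 1` for `y ≥ 0`, in the form `v²e^{−v²/(8Λ)} ≤ 16Λ·e^{−v²/(16Λ)}` (`Λ > 0`).
[folklore] -/
private lemma sq_mul_exp_le {Λ : ℝ} (hΛ : 0 < Λ) (v : ℝ) :
    v ^ 2 * Real.exp (-(v ^ 2) / (8 * Λ)) ≤ 16 * Λ * Real.exp (-(v ^ 2) / (16 * Λ)) := by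
  have hy : v ^ 2 / (16 * Λ) ≤ Real.exp (v ^ 2 / (16 * Λ)) := by
    have := Real.add_one_le_exp (v ^ 2 / (16 * Λ)); linarith
  have e1 : Real.exp (-(v ^ 2) / (8 * Λ)) =
      Real.exp (-(v ^ 2) / (16 * Λ)) * Real.exp (-(v ^ 2) / (16 * Λ)) := by
    rw [← Real.exp_add]; congr 1; field_simp; ring
  have e2 : Real.exp (-(v ^ 2) / (16 * Λ)) * Real.exp (v ^ 2 / (16 * Λ)) = 1 := by
    rw [← Real.exp_add]; simp [neg_div]
  have hpos : 0 < Real.exp (-(v ^ 2) / (16 * Λ)) := Real.exp_pos _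
  -- `v² ≤ 16Λ·exp(v²/(16Λ))`
  have h1 : v ^ 2 ≤ 16 * Λ * Real.exp (v ^ 2 / (16 * Λ)) := by
    rw [div_le_iff₀ (by positivity)] at hy; linarith
  rw [e1, ← mul_assoc]
  refine mul_le_mul_of_nonneg_right ?_ hpos.le
  calc v ^ 2 * Real.exp (-(v ^ 2) / (16 * Λ))
      ≤ 16 * Λ * Real.exp (v ^ 2 / (16 * Λ)) * Real.exp (-(v ^ 2) / (16 * Λ)) :=
        mul_le_mul_of_nonneg_right h1 hpos.le
    _ = 16 * Λ := by rw [mul_assoc, mul_comm (Real.exp _), e2, mul_one]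

/-- Pointwise: for `|v| ≥ V`, `A ≥ 0`, `Λ > 0`,
`(A + v²)e^{−v²/(4Λ)} ≤ e^{−V²/(8Λ)}(A + 16Λ)e^{−v²/(16Λ)}` (the "trivial bound for `ω₁(w)`" on the
tails of the shifted contours). [cite: Zhang2022LandauSiegel, §4 Lemma 4.4 (proof)] -/
theorem sq_weight_gauss_le {Λ A V v : ℝ} (hΛ : 0 < Λ) (hA : 0 ≤ A) (hv : V ≤ |v|) (hV : 0 ≤ V) :
    (A + v ^ 2) * Real.exp (-(v ^ 2) / (4 * Λ))
      ≤ Real.exp (-(V ^ 2) / (8 * Λ)) * ((A + 16 * Λ) * Real.exp (-(v ^ 2) / (16 * Λ))) := by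
  have hV2 : V ^ 2 ≤ v ^ 2 := by
    have := sq_abs v; nlinarith [abs_nonneg v]
  have e1 : Real.exp (-(v ^ 2) / (4 * Λ)) =
      Real.exp (-(v ^ 2) / (8 * Λ)) * Real.exp (-(v ^ 2) / (8 * Λ)) := by
    rw [← Real.exp_add]; congr 1; field_simp; ring
  have h1 : Real.exp (-(v ^ 2) / (8 * Λ)) ≤ Real.exp (-(V ^ 2) / (8 * Λ)) := by
    refine Real.exp_le_exp.mpr ?_
    rw [div_le_div_iff_of_pos_right (by positivity)]; linarith
  have h2 : Real.exp (-(v ^ 2) / (8 * Λ)) ≤ Real.exp (-(v ^ 2) / (16 * Λ)) := by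
    refine Real.exp_le_exp.mpr ?_
    rw [div_le_div_iff₀ (by positivity) (by positivity)]; nlinarith [sq_nonneg v]
  have h3 := sq_mul_exp_le hΛ v
  have hp8 : 0 < Real.exp (-(v ^ 2) / (8 * Λ)) := Real.exp_pos _
  have hp16 : 0 < Real.exp (-(v ^ 2) / (16 * Λ)) := Real.exp_pos _
  rw [e1, ← mul_assoc]
  calc (A + v ^ 2) * Real.exp (-(v ^ 2) / (8 * Λ)) * Real.exp (-(v ^ 2) / (8 * Λ))
      = Real.exp (-(v ^ 2) / (8 * Λ)) *
          (A * Real.exp (-(v ^ 2) / (8 * Λ)) + v ^ 2 * Real.exp (-(v ^ 2) / (8 * Λ))) := by ring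
    _ ≤ Real.exp (-(V ^ 2) / (8 * Λ)) *
          (A * Real.exp (-(v ^ 2) / (16 * Λ)) + 16 * Λ * Real.exp (-(v ^ 2) / (16 * Λ))) := by
        refine mul_le_mul h1 ?_ (by positivity) (by positivity)
        exact add_le_add (mul_le_mul_of_nonneg_left h2 hA) h3
    _ = Real.exp (-(V ^ 2) / (8 * Λ)) * ((A + 16 * Λ) * Real.exp (-(v ^ 2) / (16 * Λ))) := by ring

/-- **Gaussian tail with quadratic weight**: for `A ≥ 0`, `Λ > 0`, `V ≥ 0`,
`∫_{v>V} (A + v²)e^{−v²/(4Λ)} dv ≤ e^{−V²/(8Λ)}·(A + 16Λ)·√(16πΛ)` ("a trivial bound for `ω₁(w)`"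
on the tails `|v| ≥ 𝓛²⁰` of the shifted contours, p. 20). [cite: Zhang2022LandauSiegel, §4 Lemma 4.4 (proof)] -/
theorem integral_Ioi_sq_mul_gauss_le {Λ A V : ℝ} (hΛ : 0 < Λ) (hA : 0 ≤ A) (hV : 0 ≤ V) :
    ∫ v in Ioi V, (A + v ^ 2) * Real.exp (-(v ^ 2) / (4 * Λ))
      ≤ Real.exp (-(V ^ 2) / (8 * Λ)) * (A + 16 * Λ) * Real.sqrt (16 * π * Λ) := by
  have hb : 0 < 1 / (16 * Λ) := by positivity
  have hb4 : 0 < 1 / (4 * Λ) := by positivity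
  have hg : Integrable fun v : ℝ => Real.exp (-(1 / (16 * Λ)) * v ^ 2) :=
    integrable_exp_neg_mul_sq hb
  have hg' : Integrable fun v : ℝ =>
      Real.exp (-(V ^ 2) / (8 * Λ)) * ((A + 16 * Λ) * Real.exp (-(v ^ 2) / (16 * Λ))) := by
    have := (hg.const_mul (A + 16 * Λ)).const_mul (Real.exp (-(V ^ 2) / (8 * Λ)))
    refine this.congr (ae_of_all _ fun v => ?_)
    simp only
    congr 3
    field_simp
  -- the integrand itself is integrable (Gaussian moments)
  have hf1 : Integrable fun v : ℝ => Real.exp (-(1 / (4 * Λ)) * v ^ 2) := integrable_exp_neg_mul_sq hb4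
  have hf2 : Integrable fun v : ℝ => v ^ 2 * Real.exp (-(1 / (4 * Λ)) * v ^ 2) := by
    have := integrable_rpow_mul_exp_neg_mul_sq hb4 (show (-1 : ℝ) < 2 by norm_num)
    simpa [Real.rpow_two] using this
  have hf : Integrable fun v : ℝ => (A + v ^ 2) * Real.exp (-(v ^ 2) / (4 * Λ)) := by
    have := (hf1.const_mul A).add hf2
    refine this.congr (ae_of_all _ fun v => ?_)
    simp only [Pi.add_apply]
    have e : -(1 / (4 * Λ)) * v ^ 2 = -(v ^ 2) / (4 * Λ) := by field_simp
    rw [e]; ring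
  calc ∫ v in Ioi V, (A + v ^ 2) * Real.exp (-(v ^ 2) / (4 * Λ))
      ≤ ∫ v in Ioi V, Real.exp (-(V ^ 2) / (8 * Λ)) *
          ((A + 16 * Λ) * Real.exp (-(v ^ 2) / (16 * Λ))) := by
        refine setIntegral_mono_on hf.integrableOn hg'.integrableOn measurableSet_Ioi ?_
        intro v hv
        exact sq_weight_gauss_le hΛ hA ((le_of_lt hv).trans (le_abs_self v)) hV
    _ ≤ ∫ v, Real.exp (-(V ^ 2) / (8 * Λ)) *
          ((A + 16 * Λ) * Real.exp (-(v ^ 2) / (16 * Λ))) :=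
        setIntegral_le_integral hg' (ae_of_all _ fun v => by positivity)
    _ = Real.exp (-(V ^ 2) / (8 * Λ)) * (A + 16 * Λ) * Real.sqrt (16 * π * Λ) := by
        rw [integral_const_mul, integral_const_mul]
        have e : ∫ v : ℝ, Real.exp (-(v ^ 2) / (16 * Λ)) = Real.sqrt (π / (1 / (16 * Λ))) := by
          rw [← integral_gaussian]
          congr 1; funext v; congr 1; field_simp
        rw [e]
        have : π / (1 / (16 * Λ)) = 16 * π * Λ := by field_simp
        rw [this]; ring

/-- The mirror tail `∫_{v≤−V} (A + v²)e^{−v²/(4Λ)} dv ≤ e^{−V²/(8Λ)}·(A + 16Λ)·√(16πΛ)`.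
[cite: Zhang2022LandauSiegel, §4 Lemma 4.4 (proof)] -/
theorem integral_Iic_sq_mul_gauss_le {Λ A V : ℝ} (hΛ : 0 < Λ) (hA : 0 ≤ A) (hV : 0 ≤ V) :
    ∫ v in Iic (-V), (A + v ^ 2) * Real.exp (-(v ^ 2) / (4 * Λ))
      ≤ Real.exp (-(V ^ 2) / (8 * Λ)) * (A + 16 * Λ) * Real.sqrt (16 * π * Λ) := by
  have h := integral_Ioi_sq_mul_gauss_le hΛ hA hV
  have e : ∫ v in Iic (-V), (A + v ^ 2) * Real.exp (-(v ^ 2) / (4 * Λ))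
      = ∫ v in Ioi V, (A + v ^ 2) * Real.exp (-(v ^ 2) / (4 * Λ)) := by
    rw [← integral_comp_neg_Ioi]
    refine setIntegral_congr_fun measurableSet_Ioi fun v _ => ?_
    simp only [neg_sq]
  rw [e]; exact h

/-! ### The tail series `Σ_{n>P²} ν(n)ψ̄(n)n^{−z}` -/

section Tail

variable {D : ℕ} (χ : DirichletCharacter ℂ D) (x : Chr D)

/-- The absolute divisor-bound constant `C_τ ≥ 1` with `τ(n) ≤ C_τ n^{1/4}` (Hardy–Wright 315 via the
tree), chosen once. [cite: HardyWright2008, Theorem 315] -/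
private theorem tau_bound : ∃ C : ℝ, 1 ≤ C ∧ ∀ n : ℕ, n ≠ 0 →
    ((n.divisors.card : ℕ) : ℝ) ≤ C * (n : ℝ) ^ (1 / 4 : ℝ) :=
  Literature.NumberTheory.Sieve.exists_card_divisors_le_mul_rpow (by norm_num)

/-- Termwise bound: for `Re z ≥ 3/2 + b`, `b ≥ 0`, `n > P²`,
`|ν(n)ψ̄(n)n^{−z}| ≤ C_τ·(P²)^{−b}·n^{−5/4}` (and `0` for `n ≤ P²`), with `C_τ` from the divisor bound.
[cite: Zhang2022LandauSiegel, §4 (4.9) (proof)] -/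
theorem norm_tailSummand_le_uniform {C : ℝ} (hC1 : 1 ≤ C)
    (hC : ∀ n : ℕ, n ≠ 0 → ((n.divisors.card : ℕ) : ℝ) ≤ C * (n : ℝ) ^ (1 / 4 : ℝ))
    {b : ℝ} (hb : 0 ≤ b) {z : ℂ} (hz : 3 / 2 + b ≤ z.re) (hP : 1 ≤ bigP D) (n : ℕ) :
    ‖(if bigP D ^ 2 < (n : ℝ) then nu χ n * psiBarFn x n * (n : ℂ) ^ (-z) else 0)‖
      ≤ C * (bigP D ^ 2) ^ (-b) * ((n : ℝ) ^ (-(5 / 4 : ℝ))) := by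
  have hP2 : 1 ≤ bigP D ^ 2 := one_le_pow₀ hP
  split_ifs with hn
  · have hn1 : (1 : ℝ) < n := lt_of_le_of_lt hP2 hn
    have hn0 : 0 < (n : ℝ) := by linarith
    have hn0' : n ≠ 0 := by exact_mod_cast hn0.ne'
    rw [norm_mul, norm_mul, Complex.norm_natCast_cpow_of_pos (Nat.pos_of_ne_zero hn0'),
      Complex.neg_re]
    have hν : ‖nu χ n‖ ≤ C * (n : ℝ) ^ (1 / 4 : ℝ) :=
      (Literature.NumberTheory.LFunctions.norm_divisorSumChar_le χ n).trans (hC n hn0')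
    have hψ : ‖psiBarFn x n‖ ≤ 1 := by
      rw [psiBarFn, Complex.norm_conj]; exact x.ψ.norm_le_one _
    -- `n^{−Re z} ≤ n^{−3/2−b} = n^{−5/4}·n^{−1/4}·n^{−b} ≤ n^{−5/4}·n^{−1/4}·(P²)^{−b}`
    have h1 : (n : ℝ) ^ (-z.re) ≤ (n : ℝ) ^ (-(3 / 2 + b)) :=
      Real.rpow_le_rpow_of_exponent_le hn1.le (by linarith)
    have h2 : (n : ℝ) ^ (-(3 / 2 + b)) = (n : ℝ) ^ (-(5 / 4 : ℝ)) * (n : ℝ) ^ (-(1 / 4 : ℝ)) *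
        (n : ℝ) ^ (-b) := by
      rw [← Real.rpow_add hn0, ← Real.rpow_add hn0]; congr 1; ring
    have h3 : (n : ℝ) ^ (-b) ≤ (bigP D ^ 2) ^ (-b) :=
      Real.rpow_le_rpow_of_nonpos (by positivity) hn.le (by linarith)
    have h4 : C * (n : ℝ) ^ (1 / 4 : ℝ) * (n : ℝ) ^ (-(1 / 4 : ℝ)) = C := by
      rw [mul_assoc, ← Real.rpow_add hn0]; norm_num
    calc ‖nu χ n‖ * ‖psiBarFn x n‖ * (n : ℝ) ^ (-z.re)
        ≤ (C * (n : ℝ) ^ (1 / 4 : ℝ)) * 1 * (n : ℝ) ^ (-(3 / 2 + b)) := by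
          gcongr
      _ = C * (n : ℝ) ^ (1 / 4 : ℝ) * (n : ℝ) ^ (-(1 / 4 : ℝ)) * (n : ℝ) ^ (-b) *
            (n : ℝ) ^ (-(5 / 4 : ℝ)) := by rw [h2]; ring
      _ = C * (n : ℝ) ^ (-b) * (n : ℝ) ^ (-(5 / 4 : ℝ)) := by rw [h4]
      _ ≤ C * (bigP D ^ 2) ^ (-b) * (n : ℝ) ^ (-(5 / 4 : ℝ)) := by
          gcongr
  · rw [norm_zero]; positivity

/-- **The tail series is small/bounded**: for `Re z ≥ 3/2 + b` (`b ≥ 0`) and `P ≥ 1`,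
`|Σ_{n>P²} ν(n)ψ̄(n)n^{−z}| ≤ C_τ·(P²)^{−b}·Σ_{n≥1} n^{−5/4}` ("trivial bounds for … the involved
sum", p. 21; `b = 0` on the tails/horizontals, `b = 19/2` on `Re w = −σ−10`).
[cite: Zhang2022LandauSiegel, §4 (4.9) (proof)] -/
theorem norm_tailSum_le_mul_rpow {C : ℝ} (hC1 : 1 ≤ C)
    (hC : ∀ n : ℕ, n ≠ 0 → ((n.divisors.card : ℕ) : ℝ) ≤ C * (n : ℝ) ^ (1 / 4 : ℝ))
    {b : ℝ} (hb : 0 ≤ b) {z : ℂ} (hz : 3 / 2 + b ≤ z.re) (hP : 1 ≤ bigP D) :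
    ‖tailSum χ x z‖ ≤ C * (bigP D ^ 2) ^ (-b) * ∑' n : ℕ, (n : ℝ) ^ (-(5 / 4 : ℝ)) := by
  have hsum : Summable fun n : ℕ => (n : ℝ) ^ (-(5 / 4 : ℝ)) :=
    Real.summable_nat_rpow.mpr (by norm_num)
  have hmaj : Summable fun n : ℕ => C * (bigP D ^ 2) ^ (-b) * (n : ℝ) ^ (-(5 / 4 : ℝ)) :=
    hsum.mul_left _
  have hpt := norm_tailSummand_le_uniform χ x hC1 hC hb hz hP
  have hns : Summable fun n : ℕ =>
      ‖(if bigP D ^ 2 < (n : ℝ) then nu χ n * psiBarFn x n * (n : ℂ) ^ (-z) else 0)‖ :=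
    Summable.of_nonneg_of_le (fun n => norm_nonneg _) hpt hmaj
  rw [tailSum]
  calc ‖∑' n : ℕ, (if bigP D ^ 2 < (n : ℝ) then nu χ n * psiBarFn x n * (n : ℂ) ^ (-z) else 0)‖
      ≤ ∑' n : ℕ, ‖(if bigP D ^ 2 < (n : ℝ) then nu χ n * psiBarFn x n * (n : ℂ) ^ (-z) else 0)‖ :=
        norm_tsum_le_tsum_norm hns
    _ ≤ ∑' n : ℕ, C * (bigP D ^ 2) ^ (-b) * (n : ℝ) ^ (-(5 / 4 : ℝ)) :=
        hns.tsum_le_tsum hpt hmaj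
    _ = C * (bigP D ^ 2) ^ (-b) * ∑' n : ℕ, (n : ℝ) ^ (-(5 / 4 : ℝ)) := tsum_mul_left

/-- The case `b = 0`: for `Re z ≥ 3/2`, `|Σ_{n>P²} ν(n)ψ̄(n)n^{−z}| ≤ C_τ·Σ n^{−5/4}`.
[cite: Zhang2022LandauSiegel, §4 (4.9) (proof)] -/
theorem norm_tailSum_le_uniform {C : ℝ} (hC1 : 1 ≤ C)
    (hC : ∀ n : ℕ, n ≠ 0 → ((n.divisors.card : ℕ) : ℝ) ≤ C * (n : ℝ) ^ (1 / 4 : ℝ))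
    {z : ℂ} (hz : 3 / 2 ≤ z.re) (hP : 1 ≤ bigP D) :
    ‖tailSum χ x z‖ ≤ C * ∑' n : ℕ, (n : ℝ) ^ (-(5 / 4 : ℝ)) := by
  have h := norm_tailSum_le_mul_rpow χ x hC1 hC le_rfl (b := 0) (by simpa using hz) hP
  simpa using h

end Tail

/-! ### (4.5) as an upper bound at every height -/

/-- **`|Z̃(σ′+it′)| ≤ 2(k₁k₂(t′/2π)²)^{1/2−σ′}`** for primitive `ψ (mod k₁)`, `θ₂ (mod k₂)`,
`|σ′| ≤ 11`, `t′ ≥ 82080` (`= 570·12²`): the tree's exact Stirling form of (4.5)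
(`GammaFactor.abs_norm_tildeZ_sub_le`, relative error `570(A+1)²/t′ ≤ 1` with `A = 11`) read as
an upper bound — valid at EVERY height `t′`, which is what the shifted contours of (4.7)–(4.9)
(heights `t + v`, `|v| ≤ 𝓛²⁰`) require beyond the printed window of (4.5).
[cite: Zhang2022LandauSiegel, §4 (4.5)] -/
theorem norm_tildeZ_le_two_mul {k₁ k₂ : ℕ} [NeZero k₁] [NeZero k₂]
    {ψ : DirichletCharacter ℂ k₁} {θ₂ : DirichletCharacter ℂ k₂} (hψ : ψ.IsPrimitive)
    (hθ : θ₂.IsPrimitive) {σ' t' : ℝ} (hσ : |σ'| ≤ 11) (ht : 82080 ≤ t') :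
    ‖GammaFactor.tildeZ ψ θ₂ (σ' + t' * I)‖
      ≤ 2 * ((k₁ : ℝ) * k₂ * (t' / (2 * π)) ^ 2) ^ (1 / 2 - σ') := by
  have h := GammaFactor.abs_norm_tildeZ_sub_le hψ hθ (A := 11) (by norm_num) hσ
    (by norm_num at ht ⊢; linarith)
  set M : ℝ := ((k₁ : ℝ) * k₂ * (t' / (2 * π)) ^ 2) ^ (1 / 2 - σ') with hM
  have hM0 : 0 ≤ M := by rw [hM]; positivity
  have hrel : 570 * ((11 : ℝ) + 1) ^ 2 / t' ≤ 1 := by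
    rw [div_le_one (by linarith)]; norm_num; linarith
  have h1 := (abs_le.mp h).2
  have h2 : 570 * ((11 : ℝ) + 1) ^ 2 / t' * M ≤ 1 * M := mul_le_mul_of_nonneg_right hrel hM0
  linarith

end Literature.NumberTheory.LFunctions.Zhang2022.Section4
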